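import Summits.QuantumFields.BalabanUV.Beta.EriceRemainderEnclosureHistoryAutonomyComparisonAgeCompositionBVStability

/-!
# EriceRemainderEnclosureHistoryAutonomyComparisonAgeCompositionKeyFree — (E115c) route (N), first order, ABSTRACT: THE KEY-FREE, MONO-FREE COMPOSITION OF
# A YOUNG SYSTEM WITH AN OLD ONE.  Split the kernel into an old part `K_O` and a young part `K_y` (reads `R_O`, `R_y`; zero-tailed solution operators `S_O`,
# `S_y` on the horizon `N`); `ε` the zero-tailed solution of the full system `ε = e − R_O ε − R_y ε`.  (E71a) expanded `ε = Σ_i S_y S_O W_i` and needed EVERY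
# term non-negative (KEY + MONO).  Here instead: (i) the EXACT TWO-TERM IDENTITY **`sol_eq_composition`**: `ε = S_y (S_O (e + g))`, `g = R_O (R_y ε)` — the old
# system solved on the excess plus the old reads of the young drops of the TRUE surplus, then the young system; hence `ε = T_0 + S_y (S_O g)` with
# `T_0 = S_y (S_O e)` (**`sol_eq_first_add_remainder`**); (ii) a young system with row sums `≤ ρ < 1` is SUP-STABLE: `|S_y u| ≤ sup|u|∕(1−ρ)` below any pin
# (**`abs_sol_le_sup_div`**); (iii) an old system with the END at every truncation is BV-STABLE ((E115a) `abs_sol_le_var`): `|S_O g m| ≤ Var_{≥m} g`; so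
# (iv) **`sol_ge_first_sub_var`**: `ε n ≥ T_0 n − Var_{≥n} g ∕ (1 − ρ)` — THE KEY-FREE, MONO-FREE COMPOSITION BOUND: the full surplus is the first Neumann
# term up to the tail variation of `g = R_O R_y ε`, a quantity of size (old first entries) × (total young rate mass below the pin) — along admissible flows
# `O(T_O(n)·k_y∕k_{O,min})` (README `HOME/b2b-balaban-beta-d4-p2/g96/README.md` §3–§4; numerically the remainder `ε − T_0` is between 0.01 % and 1.7 %
# of `T_0` and POSITIVE on every configuration computed — row-mass maximisers to `K = 2^20`, kit `g96law` j343456; 96 spread towers, `g96law2` j343459);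
# and `T_0 n` itself is bounded below KEY-free by (E115a) `sol_ge_local` ∕ (E115b).  Since `g` involves `ε` only STRICTLY
# BELOW the pin, the bound is usable in the downward induction over the depth (the END below `n` gives `0 ≤ R_y ε ≤ x̃`).

Cell `pub-balaban`, β-function sub-cell, BINDER row D4 «RemainderConst leaves for Bałaban's split» (`HOME/BINDER-OWNERS.md`; owner lineage `b2b-balaban-beta-an4`;
this file by co-owner #2 lineage `b2b-balaban-beta-d4-p2`, generation 96), β-FLOW TEAM duty (1), FREEZE (0) honoured (def-free; imports (E115a); uses (E71a)
`sol_unique`, `read_eq_zero_of_tail`, `read_sub`, and (E115a) `read_add'`, `sol_add`, `abs_sol_le_var` BY NAME; pure renewal algebra; nothing restated).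

HONEST FRAMING (page 1, verbatim and binding).  *"Discharging BetaPertH makes Bałaban's UV stability UNCONDITIONAL — a real constructive-QFT result; it is
NOT the continuum limit and NOT the Clay problem."*  THIS FILE DISCHARGES NOTHING OF THE KIND.  Elementary linear algebra about ABSTRACT real sequences and
triangular systems — tools for the cell's own first-order census (route (N) of conjecture (E58′)); the form, signs, ages and moments of Bałaban's (1.22) limit
functional are NOT PRINTED ([I] p. 298; GAPS G-t4-U2-1∕-2) and NOT asserted.  Row D4 class UNCHANGED (critical-path width 0; instance 0∕1; D4 DISCHARGE NO
DATE).  HONEST DEPENDENCY: continuum YM on T⁴ ⇐ BetaPertH ∧ nine spine estimates (0/9 proved); BetaPertH ⇐ (D1) ∧ (D4) ∧ CAP+tail; G-an2-4 gates asym, D1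
and NE2/3/4.

NOT CLAIMED: the flow estimates of `Var g` and of the old surplus's local increase (README §6 (1)(2), open); the END beyond the tree's classes; anything
printed — NOT B12 Thm 2, NOT BetaPertH, NOT continuum, NOT Clay.

WHAT IS PROVED ([folklore]; 0 `def`, 0 sorry; (E71a)'s conventions).  §1 **`abs_sol_le_sup_div`** (sup-stability of light systems).  §2 **`sol_eq_composition`**,
**`sol_eq_first_add_remainder`**.  §3 **`sol_ge_first_sub_var`** (the KEY-free composition bound), **`sol_ge_first_sub_var_local`** (with (E115a)'s local bound
for the first term).
-/
noncomputable section
open Finset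

namespace Summit.QuantumFields.BalabanUV.Beta.EriceRemainderEnclosureHistoryAutonomyComparisonAgeCompositionKeyFree

open Summit.QuantumFields.BalabanUV.Beta.EriceRemainderEnclosureHistoryAutonomyComparisonAgeComposition
open Summit.QuantumFields.BalabanUV.Beta.EriceRemainderEnclosureHistoryAutonomyComparisonAgeCompositionBVStability

variable {N : ℕ} {K KO Ky : ℕ → ℕ → ℝ} {R S RO Ry SO Sy : (ℕ → ℝ) → ℕ → ℝ}

/-! ## §1 Sup-stability of a light system -/

/-- **SUP-STABILITY.**  Non-negative kernel with row sums `≤ ρ < 1` at the depths `≥ n`; `t` the zero-tailed solution for an input `u` with `|u m| ≤ M` for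
`m ≥ n`.  Then `|t m| ≤ M∕(1−ρ)` for every `m ≥ n` (downward induction; Neumann bound). [folklore] -/
theorem abs_sol_le_sup_div (hR : ∀ v n, R v n = ∑ l ∈ range N, K n l * v (n + 1 + l)) (hK : ∀ n l, 0 ≤ K n l)
    {n : ℕ} {ρ : ℝ} (hrow : ∀ m, n ≤ m → ∑ l ∈ range N, K m l ≤ ρ) (hρ1 : ρ < 1)
    {u t : ℕ → ℝ} (htail : ∀ m, N < m → t m = 0) (hrec : ∀ m, t m = u m - R t m)
    {M : ℝ} (hM : ∀ m, n ≤ m → |u m| ≤ M) : ∀ m, n ≤ m → |t m| ≤ M / (1 - ρ) := by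
  by_cases hnN : N < n
  · intro m hm; rw [htail m (by omega), abs_zero]
    exact div_nonneg ((abs_nonneg _).trans (hM n le_rfl)) (by linarith)
  have hM0 : 0 ≤ M := (abs_nonneg _).trans (hM n le_rfl)
  have hρ0 : 0 ≤ ρ := (sum_nonneg fun l _ => hK n l).trans (hrow n le_rfl)
  have hB0 : 0 ≤ M / (1 - ρ) := div_nonneg hM0 (by linarith)
  suffices h : ∀ d m, N < m + d → n ≤ m → |t m| ≤ M / (1 - ρ) from fun m hm => h (N + 1) m (by omega) hm
  intro d
  induction d with
  | zero => intro m hNm _; rw [htail m (by omega), abs_zero]; exact hB0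
  | succ d ih =>
    intro m hNm hnm
    by_cases hNm' : N < m
    · rw [htail m hNm', abs_zero]; exact hB0
    rw [hrec m]
    have hRt : |R t m| ≤ ρ * (M / (1 - ρ)) := by
      rw [hR]
      calc |∑ l ∈ range N, K m l * t (m + 1 + l)| ≤ ∑ l ∈ range N, |K m l * t (m + 1 + l)| := abs_sum_le_sum_abs _ _
        _ = ∑ l ∈ range N, K m l * |t (m + 1 + l)| := sum_congr rfl fun l _ => by rw [abs_mul, abs_of_nonneg (hK m l)]
        _ ≤ ∑ l ∈ range N, K m l * (M / (1 - ρ)) :=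
            sum_le_sum fun l _ => mul_le_mul_of_nonneg_left (ih (m + 1 + l) (by omega) (by omega)) (hK m l)
        _ = (∑ l ∈ range N, K m l) * (M / (1 - ρ)) := by rw [sum_mul]
        _ ≤ ρ * (M / (1 - ρ)) := mul_le_mul_of_nonneg_right (hrow m hnm) hB0
    have h1 : |u m - R t m| ≤ |u m| + |R t m| := abs_sub _ _
    have h1ρ : (1 - ρ) ≠ 0 := by linarith
    have h2 : M + ρ * (M / (1 - ρ)) = M / (1 - ρ) := by
      have h3 : ρ * (M / (1 - ρ)) * (1 - ρ) = ρ * M := by rw [mul_assoc, div_mul_cancel₀ _ h1ρ]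
      rw [eq_div_iff h1ρ, add_mul, h3]; ring
    linarith [hM m hnm]

/-! ## §2 The exact two-term composition identity -/

/-- **THE COMPOSITION IDENTITY.**  `ε` the zero-tailed solution of the full system `ε = e − R_O ε − R_y ε` (`e` zero-tailed); `g = R_O (R_y ε)`.  Then
`ε = S_y (S_O (e + g))`: indeed `ε + R_y ε` solves the old system with input `e + g`, and `ε` solves the young system with input `ε + R_y ε`
(matrix form `(I+K_O)(I+K_y) = I + K + K_OK_y`). [folklore] -/
theorem sol_eq_composition
    (hRO : ∀ v n, RO v n = ∑ l ∈ range N, KO n l * v (n + 1 + l))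
    (hRy : ∀ v n, Ry v n = ∑ l ∈ range N, Ky n l * v (n + 1 + l))
    (hSO : ∀ w : ℕ → ℝ, (∀ n, N < n → w n = 0) → (∀ n, N < n → SO w n = 0) ∧ ∀ n, SO w n = w n - RO (SO w) n)
    (hSy : ∀ w : ℕ → ℝ, (∀ n, N < n → w n = 0) → (∀ n, N < n → Sy w n = 0) ∧ ∀ n, Sy w n = w n - Ry (Sy w) n)
    {e : ℕ → ℝ} (he : ∀ n, N < n → e n = 0)
    {ε : ℕ → ℝ} (hεtail : ∀ n, N < n → ε n = 0) (hεrec : ∀ n, ε n = e n - RO ε n - Ry ε n) :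
    ∀ n, ε n = Sy (SO (fun m => e m + RO (Ry ε) m)) n := by
  -- tails
  have hRyt : ∀ m, N < m → Ry ε m = 0 := fun m hm =>
    read_eq_zero_of_tail (c := 0) hRy (fun k hk => hεtail k (by simpa using hk)) m (by omega)
  have hgt : ∀ m, N < m → RO (Ry ε) m = 0 := fun m hm =>
    read_eq_zero_of_tail (c := 0) hRO (fun k hk => hRyt k (by simpa using hk)) m (by omega)
  have hwt : ∀ m, N < m → (fun m => e m + RO (Ry ε) m) m = 0 := fun m hm => by simp only [he m hm, hgt m hm, add_zero]
  -- `ε + Ry ε` solves the old system with input `e + g`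
  have hzt : ∀ m, N < m → (fun m => ε m + Ry ε m) m = 0 := fun m hm => by simp only [hεtail m hm, hRyt m hm, add_zero]
  have hzrec : ∀ m, (fun m => ε m + Ry ε m) m = (fun m => e m + RO (Ry ε) m) m - RO (fun m => ε m + Ry ε m) m := fun m => by
    simp only [read_add' hRO]
    linarith [hεrec m]
  have hv : ∀ m, SO (fun m => e m + RO (Ry ε) m) m = ε m + Ry ε m := fun m =>
    (sol_unique hRO (hSO _ hwt).1 (hSO _ hwt).2 hzt hzrec m)
  -- `ε` solves the young system with input `ε + Ry ε`
  have hv' : SO (fun m => e m + RO (Ry ε) m) = fun m => ε m + Ry ε m := funext hv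
  intro n
  rw [hv']
  have hεrec' : ∀ m, ε m = (fun m => ε m + Ry ε m) m - Ry ε m := fun m => by simp only; ring
  exact (sol_unique hRy (hSy _ hzt).1 (hSy _ hzt).2 hεtail hεrec' n).symm

/-- **FIRST TERM PLUS REMAINDER.**  With `T_0 = S_y (S_O e)` and `g = R_O (R_y ε)`: `ε = T_0 + S_y (S_O g)`. [folklore] -/
theorem sol_eq_first_add_remainder
    (hRO : ∀ v n, RO v n = ∑ l ∈ range N, KO n l * v (n + 1 + l))
    (hRy : ∀ v n, Ry v n = ∑ l ∈ range N, Ky n l * v (n + 1 + l))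
    (hSO : ∀ w : ℕ → ℝ, (∀ n, N < n → w n = 0) → (∀ n, N < n → SO w n = 0) ∧ ∀ n, SO w n = w n - RO (SO w) n)
    (hSy : ∀ w : ℕ → ℝ, (∀ n, N < n → w n = 0) → (∀ n, N < n → Sy w n = 0) ∧ ∀ n, Sy w n = w n - Ry (Sy w) n)
    {e : ℕ → ℝ} (he : ∀ n, N < n → e n = 0)
    {ε : ℕ → ℝ} (hεtail : ∀ n, N < n → ε n = 0) (hεrec : ∀ n, ε n = e n - RO ε n - Ry ε n) :
    ∀ n, ε n = Sy (SO e) n + Sy (SO (RO (Ry ε))) n := by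
  have hRyt : ∀ m, N < m → Ry ε m = 0 := fun m hm =>
    read_eq_zero_of_tail (c := 0) hRy (fun k hk => hεtail k (by simpa using hk)) m (by omega)
  have hgt : ∀ m, N < m → RO (Ry ε) m = 0 := fun m hm =>
    read_eq_zero_of_tail (c := 0) hRO (fun k hk => hRyt k (by simpa using hk)) m (by omega)
  intro n
  rw [sol_eq_composition hRO hRy hSO hSy he hεtail hεrec n]
  have h1 : SO (fun m => e m + RO (Ry ε) m) = fun m => SO e m + SO (RO (Ry ε)) m := funext (sol_add hRO hSO he hgt)
  rw [h1]
  exact sol_add hRy hSy (hSO e he).1 (hSO _ hgt).1 n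

/-! ## §3 The KEY-free composition bound -/

/-- **THE KEY-FREE, MONO-FREE COMPOSITION BOUND.**  Old kernel `K_O ≥ 0` whose zero-tailed solution operator `S_O` has the END at every truncation
(`0 ≤ S_O 1_{[0,J]} ≤ 1`); young kernel `K_y ≥ 0` with row sums `≤ ρ < 1` at the depths `≥ n`; `ε` the zero-tailed full surplus of a zero-tailed excess
`e`; `g = R_O (R_y ε)`.  Then
`ε n ≥ S_y (S_O e) n − (Σ_{n ≤ J ≤ N} |g J − g (J+1)|) ∕ (1 − ρ)`:
the full surplus is at least the first Neumann term minus the tail variation of `g` over `1 − ρ` ((E115a) `abs_sol_le_var` for the old system, §1 for the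
young one, §2 for the identity). [folklore] -/
theorem sol_ge_first_sub_var
    (hRO : ∀ v n, RO v n = ∑ l ∈ range N, KO n l * v (n + 1 + l))
    (hRy : ∀ v n, Ry v n = ∑ l ∈ range N, Ky n l * v (n + 1 + l)) (hKy : ∀ n l, 0 ≤ Ky n l)
    (hSO : ∀ w : ℕ → ℝ, (∀ n, N < n → w n = 0) → (∀ n, N < n → SO w n = 0) ∧ ∀ n, SO w n = w n - RO (SO w) n)
    (hSy : ∀ w : ℕ → ℝ, (∀ n, N < n → w n = 0) → (∀ n, N < n → Sy w n = 0) ∧ ∀ n, Sy w n = w n - Ry (Sy w) n)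
    (hENDO : ∀ J n, J ≤ N → 0 ≤ SO (fun m => if m ≤ J then (1 : ℝ) else 0) n ∧ SO (fun m => if m ≤ J then (1 : ℝ) else 0) n ≤ 1)
    {n : ℕ} {ρ : ℝ} (hrow : ∀ m, n ≤ m → ∑ l ∈ range N, Ky m l ≤ ρ) (hρ1 : ρ < 1)
    {e : ℕ → ℝ} (he : ∀ n, N < n → e n = 0)
    {ε : ℕ → ℝ} (hεtail : ∀ n, N < n → ε n = 0) (hεrec : ∀ n, ε n = e n - RO ε n - Ry ε n) :
    Sy (SO e) n - (∑ J ∈ Ico n (N + 1), |RO (Ry ε) J - RO (Ry ε) (J + 1)|) / (1 - ρ) ≤ ε n := by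
  have hRyt : ∀ m, N < m → Ry ε m = 0 := fun m hm =>
    read_eq_zero_of_tail (c := 0) hRy (fun k hk => hεtail k (by simpa using hk)) m (by omega)
  have hgt : ∀ m, N < m → RO (Ry ε) m = 0 := fun m hm =>
    read_eq_zero_of_tail (c := 0) hRO (fun k hk => hRyt k (by simpa using hk)) m (by omega)
  rw [sol_eq_first_add_remainder hRO hRy hSO hSy he hεtail hεrec n]
  -- the old solution of `g` is bounded by the tail variation of `g` below `n`
  set V : ℝ := ∑ J ∈ Ico n (N + 1), |RO (Ry ε) J - RO (Ry ε) (J + 1)| with hV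
  have hMO : ∀ m, n ≤ m → |SO (RO (Ry ε)) m| ≤ V := fun m hm => by
    refine (abs_sol_le_var hRO hSO hENDO hgt m).trans ?_
    exact sum_le_sum_of_subset_of_nonneg (Ico_subset_Ico hm le_rfl) fun _ _ _ => abs_nonneg _
  have hy := abs_sol_le_sup_div hRy hKy hrow hρ1 (hSy _ (hSO _ hgt).1).1 (hSy _ (hSO _ hgt).1).2 hMO n le_rfl
  have := neg_abs_le (Sy (SO (RO (Ry ε))) n)
  linarith

/-- **THE KEY-FREE COMPOSITION BOUND WITH THE LOCAL FIRST TERM.**  As `sol_ge_first_sub_var`, with the first term bounded below by (E115a) `sol_ge_local`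
for the young system (floor `u ∈ [0,1]` at `n`, young lags `< k`, `k ≥ 1`, young rows `≤ ρ ≤ 1` everywhere and `≤ ρ' < 1` below `n`, `D` windows,
`b = n + D·k`) applied to the old surplus `v = S_O e ≥ 0`:
`ε n ≥ u·v n − (1−u)·Σ_{n≤J<b} max (v (J+1) − v J) 0 − ρ^D·(v b + Σ_{J≥b} |v J − v (J+1)|) − Var_{≥n} g ∕ (1 − ρ')`. [folklore] -/
theorem sol_ge_first_sub_var_local
    (hRO : ∀ v n, RO v n = ∑ l ∈ range N, KO n l * v (n + 1 + l))
    (hRy : ∀ v n, Ry v n = ∑ l ∈ range N, Ky n l * v (n + 1 + l)) (hKy : ∀ n l, 0 ≤ Ky n l)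
    (hSO : ∀ w : ℕ → ℝ, (∀ n, N < n → w n = 0) → (∀ n, N < n → SO w n = 0) ∧ ∀ n, SO w n = w n - RO (SO w) n)
    (hSy : ∀ w : ℕ → ℝ, (∀ n, N < n → w n = 0) → (∀ n, N < n → Sy w n = 0) ∧ ∀ n, Sy w n = w n - Ry (Sy w) n)
    (hENDO : ∀ J n, J ≤ N → 0 ≤ SO (fun m => if m ≤ J then (1 : ℝ) else 0) n ∧ SO (fun m => if m ≤ J then (1 : ℝ) else 0) n ≤ 1)
    (hENDy : ∀ J n, J ≤ N → 0 ≤ Sy (fun m => if m ≤ J then (1 : ℝ) else 0) n ∧ Sy (fun m => if m ≤ J then (1 : ℝ) else 0) n ≤ 1)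
    {ρ : ℝ} (hrowall : ∀ m, ∑ l ∈ range N, Ky m l ≤ ρ) (hρle : ρ ≤ 1) {k : ℕ} (hk : 1 ≤ k) (hKyk : ∀ m l, k ≤ l → Ky m l = 0)
    {n : ℕ} {ρ' : ℝ} (hrow : ∀ m, n ≤ m → ∑ l ∈ range N, Ky m l ≤ ρ') (hρ1 : ρ' < 1)
    {e : ℕ → ℝ} (he : ∀ n, N < n → e n = 0) (hv0 : ∀ m, 0 ≤ SO e m) {D : ℕ} {u : ℝ} (hu0 : 0 ≤ u) (hu1 : u ≤ 1)
    (hu : ∀ J, n ≤ J → J ≤ N → u ≤ Sy (fun m => if m ≤ J then (1 : ℝ) else 0) n)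
    {ε : ℕ → ℝ} (hεtail : ∀ n, N < n → ε n = 0) (hεrec : ∀ n, ε n = e n - RO ε n - Ry ε n) :
    u * SO e n - (1 - u) * ∑ J ∈ Ico n (n + D * k), max (SO e (J + 1) - SO e J) 0
      - ρ ^ D * (SO e (n + D * k) + ∑ J ∈ Ico (n + D * k) (N + 1), |SO e J - SO e (J + 1)|)
      - (∑ J ∈ Ico n (N + 1), |RO (Ry ε) J - RO (Ry ε) (J + 1)|) / (1 - ρ') ≤ ε n := by
  have h1 := sol_ge_first_sub_var hRO hRy hKy hSO hSy hENDO hrow hρ1 he hεtail hεrec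
  have h2 := sol_ge_local hRy hSy hKy hrowall hρle hk hKyk hENDy (hSO e he).1 hv0 (n := n) (D := D) hu0 hu1 hu
  linarith

end Summit.QuantumFields.BalabanUV.Beta.EriceRemainderEnclosureHistoryAutonomyComparisonAgeCompositionKeyFree

end
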